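import Summits.CriticalPhenomena.PercolationContinuityZ3.Theorems.PercNearOneGluingNoHeavyLowerTailSahiThreeDimFKG

/-!
# `NoHeavyLowerTail` (crux stmt-CriticalPhenomena-4575), Sahi programme P1: the WIDTH STRATIFICATION in every dimension —
# Lieb–Sahi for product weights on `d`-dimensional grids ⟺ Sahi for all FKG weights on `d`-dimensional grids

Support file (Sahi cell, seat `prim-sahi-p1`, generation 3; `--supports stmt-CriticalPhenomena-4575`).

`…SahiThreeDimFKG` proved the case `d = 3`; this file does every `d` at once, by induction on `d`, for the grids
`[b+1]^d = (Fin d → Fin (b+1))` (every product of `d` finite chains embeds into such a grid as a sublattice, so nothing is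
lost — `sahiPositive_of_latticeEmbedding_grid`).  For a fixed order `n` and dimension `d` write

* `P(d,n)`: every PRODUCT probability weight `⊗_i g_i` on every grid `[K+1]^d` satisfies `E_n ≥ 0` for all nonnegative
  monotone families (Lieb–Sahi's Conjecture 1.1 for `[0,1]^d`, discrete product form, at order `n`);
* `W(d,n)`: every FKG (log-supermodular) probability weight on every grid `[b+1]^d` does.

THEOREM `liebSahi_grid_iff_fkg_grid`: `P(d,n) ⟺ W(d,n)`; and (`sahiPositive_of_latticeEmbedding_grid`) `P(d,n)` implies
`E_n ≥ 0` for every FKG weight on every finite distributive lattice admitting a lattice embedding into a `d`-dimensional grid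
(Dilworth–Birkhoff: J-width `≤ d`).  Every finite distributive lattice has finite J-width, so Sahi's Conjecture 5 /
Lieb–Sahi's Conjecture 1.1 is the conjunction over `d` of the statements `P(d,·)` about PRODUCT measures on `d`-dimensional
grids — a stratification by width = dimension (`d ≤ 2` proved: chains, and generation 2's two-dimensional theorem from
[LiebSahi2021, Thm. 3.7]; `d = 3` is the first open layer).  Kahn's "underlying independents" [Kahn2022, p. 2] reduce FKG
weights to product weights on cubes `{0,1}^N` of unbounded dimension; here the dimension is preserved.

Proof: the conditional-quantile (Rosenblatt) transform, coordinate by coordinate, with ONE common quantile grid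
`0 = γ_0 < ⋯ < γ_K = 1`: `exists_gridCoupling` shows by induction on `d` that for every finite distributive parameter lattice
`T` and every FKG weight `μ` on `T × [b+1]^d` there is a finite set `C₀ ⊆ [0,1]` such that for every grid `γ ⊇ C₀` a
MONOTONE map `G : T × [K]^d → T × [b+1]^d` pushes `ν_T ⊗ (γ-gaps)^{⊗d}` forward to `μ` (`ν_T` the `T`-marginal).  The step
`d → d+1` conditions on the first grid coordinate: the parameter lattice becomes `T × [b+1]` (still distributive, its
marginal FKG by Karlin–Rinott), the lattice-indexed row-quantile coupling of `…SahiThreeDimCoupling` handles the new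
coordinate, and the two couplings compose because they use the same grid.  With `T` a point this exhibits `μ` as a monotone
image of the product weight `(γ-gaps)^{⊗d}` on `[K]^d`.  New mathematics, not in print.
-/

namespace Summit.CriticalPhenomena.PercolationContinuityZ3.Theorems.SahiWidth

open Finset Function Literature.Combinatorics.Sahi2008 SahiTwoDim SahiThreeDim
open scoped BigOperators

noncomputable section

universe u

/-! ## Small lemmas on grids -/

section Grid

variable {X : Type*} {d K : ℕ}

/-- A product over the coordinates of a `cons`-ed grid point splits off the first coordinate. [folklore] -/
theorem prod_consOrderIso (f : X → ℝ) (a : X) (ω : Fin d → X) [LE X] :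
    ∏ i : Fin (d + 1), f ((Fin.consOrderIso (fun _ : Fin (d + 1) => X) (a, ω)) i) = f a * ∏ i, f (ω i) := by
  rw [Fin.prod_univ_succ]
  simp [Fin.consOrderIso]

/-- A sum over the points of `[b+1]^{d+1}` as a double sum (first coordinate, rest). [folklore] -/
theorem sum_grid_succ [LE X] [Fintype X] (F : (Fin (d + 1) → X) → ℝ) :
    ∑ m, F m = ∑ a : X, ∑ ω : Fin d → X, F (Fin.consOrderIso (fun _ : Fin (d + 1) => X) (a, ω)) := by
  rw [← (Fin.consOrderIso (fun _ : Fin (d + 1) => X)).toEquiv.sum_comp F, Fintype.sum_prod_type]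
  rfl

/-- A product of nonnegative weights of mass one on the coordinates of a grid is an FKG probability weight (the lattice
condition holds with equality, coordinate by coordinate). [this work] -/
theorem isFKGMeasure_gridProd {K : ℕ} (g : Fin d → Fin (K + 1) → ℝ) (hg0 : ∀ i u, 0 ≤ g i u)
    (hg1 : ∀ i, ∑ u, g i u = 1) : IsFKGMeasure (fun ω : Fin d → Fin (K + 1) => ∏ i, g i (ω i)) := by
  classical
  refine ⟨fun ω => prod_nonneg fun i _ => hg0 i _, ?_, fun ω ω' => ?_⟩
  · have h := Finset.sum_prod_piFinset (univ : Finset (Fin (K + 1))) g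
    rw [Fintype.piFinset_univ] at h
    rw [h]
    exact prod_eq_one fun i _ => hg1 i
  · rw [← prod_mul_distrib, ← prod_mul_distrib]
    refine le_of_eq (prod_congr rfl fun i _ => ?_)
    rw [Pi.inf_apply, Pi.sup_apply, mul_inf_sup_eq]

end Grid

/-! ## The parametrised grid coupling -/

section Coupling

/-- **The parametrised grid coupling** (induction on the dimension `d`).  For a finite distributive parameter lattice `T`
and an FKG probability weight `μ` on `T × [b+1]^d` there is a finite set `C₀ ⊆ [0,1]` such that for every strictly
increasing grid `0 = γ_0 < ⋯ < γ_K = 1` containing `C₀`, with gap weights `g_u = γ_{u+1} − γ_u`, some MONOTONE map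
`G : T × [K]^d → T × [b+1]^d` pushes the weight `ν_T(t) · ∏_i g(ω_i)` (with `ν_T(t) = Σ_m μ(t,m)`) forward to `μ`.
[this work] -/
theorem exists_gridCoupling : ∀ (d : ℕ) {T : Type u} [DistribLattice T] [Fintype T] (b : ℕ)
    (μ : T × (Fin d → Fin (b + 1)) → ℝ), IsFKGMeasure μ →
    ∃ C₀ : Finset ℝ, (∀ c ∈ C₀, 0 ≤ c ∧ c ≤ 1) ∧
      ∀ (K : ℕ) (γ : Fin (K + 1) → ℝ) (g : Fin K → ℝ), StrictMono γ → γ 0 = 0 → γ (Fin.last K) = 1 →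
        (∀ u, g u = γ u.succ - γ (Fin.castSucc u)) → (∀ c ∈ C₀, ∃ v, γ v = c) →
        ∃ G : T × (Fin d → Fin K) → T × (Fin d → Fin (b + 1)), Monotone G ∧
          pushWeight (fun x : T × (Fin d → Fin K) => (∑ m, μ (x.1, m)) * ∏ i, g (x.2 i)) G = μ
  | 0, T, _, _, b, μ, hμ => by
    classical
    refine ⟨∅, fun c hc => absurd hc (Finset.notMem_empty c), ?_⟩
    intro K γ g _ _ _ _ _
    refine ⟨fun x => (x.1, default), fun x y h => ⟨h.1, le_rfl⟩, ?_⟩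
    funext ⟨t, m⟩
    have hm : m = default := Subsingleton.elim _ _
    subst hm
    rw [pushWeight_apply, Fintype.sum_prod_type]
    rw [Finset.sum_eq_single t]
    · rw [Fintype.sum_unique, if_pos rfl, Fintype.prod_empty, mul_one, Fintype.sum_unique]
      exact congrArg μ (Prod.ext rfl (Subsingleton.elim _ _))
    · intro t' _ ht'
      refine sum_eq_zero fun ω _ => if_neg fun h => ht' (Prod.mk.inj h).1
    · exact fun h => (h (mem_univ _)).elim
  | d + 1, T, _, _, b, μ, hμ => by
    classical
    -- split off the first grid coordinate: `T × [b+1]^{d+1} ≃ (T × [b+1]) × [b+1]^d`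
    obtain ⟨e, he⟩ : ∃ e : Fin (b + 1) × (Fin d → Fin (b + 1)) ≃o (Fin (d + 1) → Fin (b + 1)),
        e = Fin.consOrderIso fun _ => Fin (b + 1) := ⟨_, rfl⟩
    obtain ⟨E, hE⟩ : ∃ E : (T × Fin (b + 1)) × (Fin d → Fin (b + 1)) ≃ T × (Fin (d + 1) → Fin (b + 1)),
        ∀ x, E x = (x.1.1, e (x.1.2, x.2)) :=
      ⟨(Equiv.prodAssoc _ _ _).trans ((Equiv.refl T).prodCongr e.toEquiv), fun x => rfl⟩
    have hEmono : Monotone E := fun x y h => by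
      rw [hE, hE]
      exact ⟨h.1.1, e.monotone ⟨h.1.2, h.2⟩⟩
    have hEinf : ∀ x y, E (x ⊓ y) = E x ⊓ E y := fun x y => by
      rw [hE, hE, hE]
      refine Prod.ext rfl ?_
      show e ((x ⊓ y).1.2, (x ⊓ y).2) = e (x.1.2, x.2) ⊓ e (y.1.2, y.2)
      rw [← e.map_inf]
      rfl
    have hEsup : ∀ x y, E (x ⊔ y) = E x ⊔ E y := fun x y => by
      rw [hE, hE, hE]
      refine Prod.ext rfl ?_
      show e ((x ⊔ y).1.2, (x ⊔ y).2) = e (x.1.2, x.2) ⊔ e (y.1.2, y.2)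
      rw [← e.map_sup]
      rfl
    obtain ⟨μ'', hμ''⟩ : ∃ μ'' : (T × Fin (b + 1)) × (Fin d → Fin (b + 1)) → ℝ, μ'' = fun x => μ (E x) := ⟨_, rfl⟩
    have hFKG'' : IsFKGMeasure μ'' := by
      refine ⟨fun x => by rw [hμ'']; exact hμ.nonneg _, ?_, fun x y => ?_⟩
      · rw [hμ'', ← hμ.sum_eq_one]
        exact E.sum_comp (fun p => μ p)
      · rw [hμ'']
        have h := hμ.mul_le_mul (E x) (E y)
        rwa [← hEinf, ← hEsup] at h
    have hpushE : pushWeight μ'' E = μ := by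
      funext q
      rw [pushWeight_equiv, hμ'']
      exact congrArg μ (E.apply_symm_apply q)
    -- induction hypothesis with parameter lattice `T × [b+1]`
    obtain ⟨C₀', hC₀'01, hIH⟩ := exists_gridCoupling d b μ'' hFKG''
    -- level one: the `(T × [b+1])`-marginal, rows indexed by the lattice `T`
    obtain ⟨ν, hν⟩ : ∃ ν : T × Fin (b + 1) → ℝ, ν = fun y => ∑ m, μ'' (y, m) := ⟨_, rfl⟩
    have hνFKG : IsFKGMeasure ν := by
      rw [hν, ← pushWeight_fst_eq]
      exact hFKG''.pushWeight_fst
    obtain ⟨C₁, hC₁⟩ : ∃ C₁ : Finset ℝ, C₁ = univ.image fun p : T × Fin (b + 1) =>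
        (∑ j', if j' ≤ p.2 then ν (p.1, j') else 0) / (∑ j, ν (p.1, j)) := ⟨_, rfl⟩
    have hC₁01 : ∀ c ∈ C₁, 0 ≤ c ∧ c ≤ 1 := by
      intro c hc
      rw [hC₁, mem_image] at hc
      obtain ⟨p, _, rfl⟩ := hc
      by_cases hr : 0 < ∑ j, ν (p.1, j)
      · exact ⟨div_nonneg (rowCDF_nonneg ν hνFKG.nonneg _ _) hr.le,
          (div_le_one hr).2 (rowCDF_le_rowMass ν hνFKG.nonneg _ _)⟩
      · have hr0 : (∑ j, ν (p.1, j)) = 0 := le_antisymm (not_lt.1 hr) (sum_nonneg fun j _ => hνFKG.nonneg _)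
        rw [hr0, div_zero]
        exact ⟨le_rfl, zero_le_one⟩
    refine ⟨C₀' ∪ C₁, fun c hc => ?_, ?_⟩
    · rcases mem_union.1 hc with hc | hc
      · exact hC₀'01 c hc
      · exact hC₁01 c hc
    intro K γ g hγ hγ0 hγ1 hg hγC
    -- the two couplings on the common grid
    obtain ⟨G', hG'mono, hG'push⟩ := hIH K γ g hγ hγ0 hγ1 hg fun c hc => hγC c (mem_union_left _ hc)
    have hC : ∀ i j, 0 < (∑ j, ν (i, j)) →
        ∃ v, γ v * (∑ j, ν (i, j)) = (∑ j', if j' ≤ j then ν (i, j') else 0) := by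
      intro i j hri
      obtain ⟨v, hv⟩ := hγC _ (mem_union_right _ (by rw [hC₁]; exact mem_image_of_mem _ (mem_univ (i, j))))
      exact ⟨v, by rw [hv, div_mul_cancel₀ _ hri.ne']⟩
    obtain ⟨G₁, hG₁mono, hG₁push⟩ := exists_rowQuantile_coupling ν hνFKG.nonneg
      (fun i i' j hii' _ _ => SahiThreeDim.cdf_cross_of_mul_le_mul ν hνFKG.mul_le_mul hii' j) γ hγ hγ1 hγ0 hC
    have hG₁push' : pushWeight (fun p : T × Fin K => (∑ j, ν (p.1, j)) * g p.2) G₁ = ν := by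
      refine Eq.trans ?_ hG₁push
      congr 1
      funext p
      rw [hg]
    -- the source-side splitting `T × [K]^{d+1} ≃ (T × [K]) × [K]^d`
    obtain ⟨eK, heK⟩ : ∃ eK : Fin K × (Fin d → Fin K) ≃o (Fin (d + 1) → Fin K),
        eK = Fin.consOrderIso fun _ => Fin K := ⟨_, rfl⟩
    obtain ⟨F₁, hF₁⟩ : ∃ F₁ : T × (Fin (d + 1) → Fin K) ≃ (T × Fin K) × (Fin d → Fin K),
        ∀ y, F₁.symm y = (y.1.1, eK (y.1.2, y.2)) :=
      ⟨((Equiv.prodAssoc _ _ _).trans ((Equiv.refl T).prodCongr eK.toEquiv)).symm, fun y => rfl⟩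
    have hF₁mono : Monotone F₁ := by
      intro x y h
      have h1 : F₁.symm (F₁ x) ≤ F₁.symm (F₁ y) := by rw [F₁.symm_apply_apply, F₁.symm_apply_apply]; exact h
      rw [hF₁, hF₁] at h1
      obtain ⟨h11, h12⟩ := h1
      have h2 := eK.le_iff_le.1 h12
      exact ⟨⟨h11, h2.1⟩, h2.2⟩
    -- the composite coupling
    refine ⟨fun x => E (G' (G₁ (F₁ x).1, (F₁ x).2)), fun x y h => ?_, ?_⟩
    · have h1 := hF₁mono h
      exact hEmono (hG'mono ⟨hG₁mono h1.1, h1.2⟩)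
    -- push-forward, stage by stage
    have hmass : ∀ t : T, (∑ m, μ (t, m)) = ∑ j, ν (t, j) := by
      intro t
      rw [hν]
      simp only [hμ'', hE]
      rw [sum_grid_succ]
      exact sum_congr rfl fun a _ => (sum_congr rfl fun ω _ => by rw [he])
    have h1 : pushWeight (fun x : T × (Fin (d + 1) → Fin K) => (∑ m, μ (x.1, m)) * ∏ i, g (x.2 i)) F₁ =
        fun y => ((∑ j, ν (y.1.1, j)) * g y.1.2) * ∏ i, g (y.2 i) := by
      funext y
      rw [pushWeight_equiv, hF₁, hmass]
      show (∑ j, ν (y.1.1, j)) * ∏ i, g ((eK (y.1.2, y.2)) i) = _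
      rw [heK, prod_consOrderIso, mul_assoc]
    have h2 : pushWeight (fun y : (T × Fin K) × (Fin d → Fin K) => ((∑ j, ν (y.1.1, j)) * g y.1.2) * ∏ i, g (y.2 i))
        (fun y => (G₁ y.1, y.2)) = fun z => ν z.1 * ∏ i, g (z.2 i) := by
      rw [pushWeight_prodMap_id (fun p : T × Fin K => (∑ j, ν (p.1, j)) * g p.2) (fun ω : Fin d → Fin K => ∏ i, g (ω i)) G₁,
        hG₁push']
    have h3 : pushWeight (fun z : (T × Fin (b + 1)) × (Fin d → Fin K) => ν z.1 * ∏ i, g (z.2 i)) G' = μ'' := by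
      rw [← hG'push]
      congr 1
      funext z
      rw [hν]
    have hcomp : (fun x : T × (Fin (d + 1) → Fin K) => E (G' (G₁ (F₁ x).1, (F₁ x).2))) =
        E ∘ G' ∘ (fun y : (T × Fin K) × (Fin d → Fin K) => (G₁ y.1, y.2)) ∘ F₁ := rfl
    rw [hcomp, ← pushWeight_pushWeight, ← pushWeight_pushWeight, ← pushWeight_pushWeight, h1, h2, h3, hpushE]

end Coupling

/-! ## The width stratification -/

section Main

variable {d : ℕ} {n : ℕ}

/-- **`P(d,n) ⇒ W(d,n)`**: if every product probability weight on every grid `[K+1]^d` satisfies Sahi's `E_n ≥ 0`, then so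
does every FKG probability weight on every grid `[b+1]^d`. [this work] -/
theorem sahiPositive_of_isFKGMeasure_grid
    (Hd : ∀ (K : ℕ) (g : Fin d → Fin (K + 1) → ℝ), (∀ i u, 0 ≤ g i u) → (∀ i, ∑ u, g i u = 1) →
      SahiPositive (fun ω : Fin d → Fin (K + 1) => ∏ i, g i (ω i)) n)
    {b : ℕ} {μ : (Fin d → Fin (b + 1)) → ℝ} (hμ : IsFKGMeasure μ) : SahiPositive μ n := by
  classical
  -- parameter lattice = a point
  obtain ⟨μ', hμ'⟩ : ∃ μ' : PUnit.{1} × (Fin d → Fin (b + 1)) → ℝ, μ' = fun x => μ x.2 := ⟨_, rfl⟩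
  have hFKG' : IsFKGMeasure μ' := by
    refine ⟨fun x => by rw [hμ']; exact hμ.nonneg _, ?_, fun x y => by rw [hμ']; exact hμ.mul_le_mul _ _⟩
    rw [hμ', Fintype.sum_prod_type, Fintype.sum_unique]
    exact hμ.sum_eq_one
  obtain ⟨C₀, hC₀01, hcoup⟩ := exists_gridCoupling d b μ' hFKG'
  -- a grid through `C₀ ∪ {0, 1}`
  obtain ⟨C, hC⟩ : ∃ C : Finset ℝ, C = insert 0 (insert 1 C₀) := ⟨_, rfl⟩
  have h0C : (0 : ℝ) ∈ C := by rw [hC]; exact mem_insert_self _ _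
  have h1C : (1 : ℝ) ∈ C := by rw [hC]; exact mem_insert_of_mem (mem_insert_self _ _)
  have hCb : ∀ c ∈ C, 0 ≤ c ∧ c ≤ 1 := by
    intro c hc
    rw [hC, mem_insert, mem_insert] at hc
    rcases hc with rfl | rfl | hc
    · exact ⟨le_rfl, zero_le_one⟩
    · exact ⟨zero_le_one, le_rfl⟩
    · exact hC₀01 c hc
  have hcard : 2 ≤ C.card := by
    have : ({0, 1} : Finset ℝ) ⊆ C := by
      intro c hc
      simp only [mem_insert, mem_singleton] at hc
      rcases hc with rfl | rfl
      · exact h0C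
      · exact h1C
    calc 2 = ({0, 1} : Finset ℝ).card := by rw [card_pair zero_ne_one]
      _ ≤ C.card := card_le_card this
  obtain ⟨K, hK⟩ : ∃ K, C.card = (K + 1) + 1 := ⟨C.card - 2, by omega⟩
  obtain ⟨γ, hγdef⟩ : ∃ γ : Fin (K + 1 + 1) → ℝ, γ = fun v => C.orderEmbOfFin hK v := ⟨_, rfl⟩
  have hγ : StrictMono γ := by rw [hγdef]; exact (C.orderEmbOfFin hK).strictMono
  have hγ0 : γ 0 = 0 := by
    rw [hγdef]
    show C.orderEmbOfFin hK ⟨0, by omega⟩ = 0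
    rw [orderEmbOfFin_zero hK (by omega)]
    exact le_antisymm (min'_le _ _ h0C) ((hCb _ (min'_mem _ _)).1)
  have hγ1 : γ (Fin.last (K + 1)) = 1 := by
    rw [hγdef]
    show C.orderEmbOfFin hK ⟨K + 1, by omega⟩ = 1
    have h := orderEmbOfFin_last hK (by omega)
    simp only [Nat.add_sub_cancel] at h
    rw [h]
    exact le_antisymm ((hCb _ (max'_mem _ _)).2) (le_max' _ _ h1C)
  have hγC : ∀ c ∈ C₀, ∃ v, γ v = c := by
    intro c hc
    have h : c ∈ Set.range (C.orderEmbOfFin hK) := by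
      rw [range_orderEmbOfFin, hC]; exact mem_insert_of_mem (mem_insert_of_mem hc)
    obtain ⟨v, hv⟩ := h
    exact ⟨v, by rw [hγdef]; exact hv⟩
  obtain ⟨G, hGmono, hGpush⟩ := hcoup (K + 1) γ (fun u => γ u.succ - γ (Fin.castSucc u)) hγ hγ0 hγ1 (fun u => rfl) hγC
  -- the source is the product weight `(γ-gaps)^{⊗d}` on `[K+1]^d`, up to the trivial factor `PUnit`
  have hg0 : ∀ u : Fin (K + 1), 0 ≤ γ u.succ - γ (Fin.castSucc u) :=
    fun u => sub_nonneg.2 (hγ.monotone (Fin.castSucc_le_succ u))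
  have hg1 : ∑ u : Fin (K + 1), (γ u.succ - γ (Fin.castSucc u)) = 1 := sum_gaps_univ γ hγ0 hγ1
  have hsrc : SahiPositive (fun ω : Fin d → Fin (K + 1) => ∏ i, (γ (ω i).succ - γ (Fin.castSucc (ω i)))) n :=
    Hd K (fun _ u => γ u.succ - γ (Fin.castSucc u)) (fun _ u => hg0 u) (fun _ => hg1)
  have hmass : ∀ t : PUnit.{1}, (∑ m, μ' (t, m)) = 1 := by
    intro t; rw [hμ']; exact hμ.sum_eq_one
  have hsrc' : SahiPositive (fun x : PUnit.{1} × (Fin d → Fin (K + 1)) =>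
      (∑ m, μ' (x.1, m)) * ∏ i, (γ (x.2 i).succ - γ (Fin.castSucc (x.2 i)))) n := by
    have hpush : pushWeight (fun ω : Fin d → Fin (K + 1) => ∏ i, (γ (ω i).succ - γ (Fin.castSucc (ω i))))
        (fun ω => (PUnit.unit, ω)) = fun x : PUnit.{1} × (Fin d → Fin (K + 1)) =>
          (∑ m, μ' (x.1, m)) * ∏ i, (γ (x.2 i).succ - γ (Fin.castSucc (x.2 i))) := by
      funext x
      rw [hmass, one_mul]
      have hinj : Function.Injective (fun ω : Fin d → Fin (K + 1) => ((PUnit.unit, ω) : PUnit.{1} × _)) :=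
        fun ω ω' h => (Prod.mk.inj h).2
      have hx : x = (PUnit.unit, x.2) := Prod.ext (Subsingleton.elim _ _) rfl
      rw [hx]
      exact pushWeight_apply_of_injective _ hinj x.2
    rw [← hpush]
    exact SahiPositive.of_pushWeight hsrc fun ω ω' h => ⟨le_rfl, h⟩
  have hpos' : SahiPositive μ' n := by
    rw [← hGpush]
    exact SahiPositive.of_pushWeight hsrc' hGmono
  -- project back to the grid
  have hpush : pushWeight μ' Prod.snd = μ := by
    funext m
    rw [pushWeight_apply, Fintype.sum_prod_type, Fintype.sum_unique, Finset.sum_eq_single m]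
    · rw [if_pos rfl, hμ']
    · intro m' _ hm'
      exact if_neg hm'
    · exact fun h => (h (mem_univ _)).elim
  rw [← hpush]
  exact SahiPositive.of_pushWeight hpos' fun x y h => h.2

/-- **Sublattices of `d`-dimensional grids.**  Under `P(d,n)`: if a finite distributive lattice `L` admits an injective
map into a grid `[b+1]^d` preserving `⊓` and `⊔` (equivalently, by Dilworth–Birkhoff, its poset of join-irreducibles has
width `≤ d`; every product of `d` finite chains qualifies), then every FKG probability weight on `L` satisfies `E_n ≥ 0`.
[this work] -/
theorem sahiPositive_of_latticeEmbedding_grid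
    (Hd : ∀ (K : ℕ) (g : Fin d → Fin (K + 1) → ℝ), (∀ i u, 0 ≤ g i u) → (∀ i, ∑ u, g i u = 1) →
      SahiPositive (fun ω : Fin d → Fin (K + 1) => ∏ i, g i (ω i)) n)
    {L : Type*} [DistribLattice L] [Fintype L] [DecidableEq L] {b : ℕ} (e : L → (Fin d → Fin (b + 1)))
    (he : Function.Injective e) (hinf : ∀ x y, e (x ⊓ y) = e x ⊓ e y) (hsup : ∀ x y, e (x ⊔ y) = e x ⊔ e y)
    {μ : L → ℝ} (hμ : IsFKGMeasure μ) : SahiPositive μ n := by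
  classical
  have hL : Nonempty L := by
    by_contra h
    rw [not_nonempty_iff] at h
    exact one_ne_zero (hμ.sum_eq_one.symm.trans (Fintype.sum_empty _))
  letI : OrderBot L := Fintype.toOrderBot L
  have hle : ∀ x y, e x ≤ e y ↔ x ≤ y := by
    intro x y
    constructor
    · intro h
      have h1 : e (x ⊓ y) = e x := by rw [hinf]; exact inf_eq_left.2 h
      exact inf_eq_left.1 (he h1)
    · intro h
      have h1 : e x ⊓ e y = e x := by rw [← hinf, inf_eq_left.2 h]
      exact inf_eq_left.1 h1
  obtain ⟨R, hR⟩ : ∃ R : (Fin d → Fin (b + 1)) → L, ∀ p, R p = (univ.filter fun x => e x ≤ p).sup id :=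
    ⟨_, fun p => rfl⟩
  have hRmono : Monotone R := by
    intro p p' hpp'
    rw [hR, hR]
    refine Finset.sup_mono fun x hx => ?_
    rw [mem_filter] at hx ⊢
    exact ⟨hx.1, hx.2.trans hpp'⟩
  have hRE : ∀ x, R (e x) = x := by
    intro x
    rw [hR]
    refine le_antisymm (Finset.sup_le fun y hy => ?_) ?_
    · rw [mem_filter] at hy
      exact (hle y x).1 hy.2
    · exact Finset.le_sup (f := id) (by rw [mem_filter]; exact ⟨mem_univ _, le_rfl⟩)
  have hFKG : IsFKGMeasure (pushWeight μ e) := isFKGMeasure_pushWeight hμ he hinf hsup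
  exact SahiCubeAllOrders.sahiPositive_of_pushWeight_of_retract hRmono hRE
    (sahiPositive_of_isFKGMeasure_grid Hd hFKG)

/-- **THE WIDTH STRATIFICATION, every dimension, every order**: for each `d` and `n`, Sahi's `E_n ≥ 0` for every PRODUCT
probability weight on every `d`-dimensional grid `[K+1]^d` (Lieb–Sahi's Conjecture 1.1 for `[0,1]^d` at order `n`,
discrete product form) is EQUIVALENT to `E_n ≥ 0` for every FKG probability weight on every `d`-dimensional grid
`[b+1]^d` (hence, by `sahiPositive_of_latticeEmbedding_grid`, on every finite distributive lattice of J-width `≤ d`).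
[this work] -/
theorem liebSahi_grid_iff_fkg_grid (d n : ℕ) :
    (∀ (K : ℕ) (g : Fin d → Fin (K + 1) → ℝ), (∀ i u, 0 ≤ g i u) → (∀ i, ∑ u, g i u = 1) →
      SahiPositive (fun ω : Fin d → Fin (K + 1) => ∏ i, g i (ω i)) n) ↔
    ∀ (b : ℕ) (μ : (Fin d → Fin (b + 1)) → ℝ), IsFKGMeasure μ → SahiPositive μ n :=
  ⟨fun Hd _ _ hμ => sahiPositive_of_isFKGMeasure_grid Hd hμ,
    fun H K g hg0 hg1 => H K _ (isFKGMeasure_gridProd g hg0 hg1)⟩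

end Main

end

end Summit.CriticalPhenomena.PercolationContinuityZ3.Theorems.SahiWidth
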